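import Summits.Ventures.PercRepro.RankLevelSetExplicitLin2LargeSharp
import Summits.Ventures.PercRepro.RankLevelSetExplicitLin2TailChernoff

/-!
# PercRepro — THE LEVEL FROM ANY KEY ROW WITH THE CHERNOFF TAIL AND BOTH LARGE-CORANK REGIMES FROM BASES (p9, S4)

`proofs/SUBCLAIM-S4-p9.md` §S4.2⁗‴. Two crude thresholds cap the rows below `≈ 2·2^q`: the `(Y)`-tail `2d + 3q + 5 ≤ p` of
the core (`sixteen_mul_sum_range_choose_le` at `n ≥ 3K + 5`) and regime two of the large-corank theorem
(`regime_two` at `p ≥ 2^{q+1} + 3q + 2`). Both are monotone in the rank, so ONE kernel evaluation at a base suffices: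
`regime_two_of_base` (as `regime_one_of_base`, RankLevelSetExplicitLin2LargeSharp) and `c025_core_explicit_large_of'` —
the large-corank theorem with BOTH regimes from bases; and the Chernoff tail (RankLevelSetExplicitLin2TailChernoff:
`16·Σ_{j ≤ K} C(n, j) ≤ 2^n` for `8n ≥ 17K + 216`) replaces `3K + 5`. `c025_level_succ_of_key_row_tail` assembles the level
from any monotone key row whose core law takes the tail inequality as a hypothesis (the core of
RankLevelSetExplicitLin2CoreMultTail), under `8p₀ ≥ 9(q + 1 + 2^{q+1}) + 17(q + 1) + 216` (`p₀ ≥ (9/8)·2^{q+1} + …`) —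
the per-corank tail `8p ≥ 9d + 17(q+1) + 216` at every core corank. Axioms: standard.
-/

open scoped Matroid

namespace PercRepro

namespace ThmN

namespace Explicit

/-- **REGIME TWO IS MONOTONE IN THE RANK** (`p ≥ q + 2`): from `2^{p+q}·2^e·(2a+1) ≤ 4^a` (`a = p − 1 − q`) to the same at
`p + 1` — the left side grows by `2·(2a+3)/(2a+1) ≤ 4`, the right side by `4`. -/
theorem regime_two_succ (q p : ℕ) (hp : q + 2 ≤ p)
    (h : 2 ^ (p + q) * 2 ^ (2 ^ q - 1 - q) * (2 * (p - 1 - q) + 1) ≤ 4 ^ (p - 1 - q)) :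
    2 ^ (p + 1 + q) * 2 ^ (2 ^ q - 1 - q) * (2 * (p + 1 - 1 - q) + 1) ≤ 4 ^ (p + 1 - 1 - q) := by
  set a := p - 1 - q with ha
  have ha1 : 1 ≤ a := by omega
  rw [show p + 1 - 1 - q = a + 1 by omega, show p + 1 + q = (p + q) + 1 by ring, pow_succ, pow_succ]
  set X := 2 ^ (p + q) * 2 ^ (2 ^ q - 1 - q) with hX
  calc 2 ^ (p + q) * 2 * 2 ^ (2 ^ q - 1 - q) * (2 * (a + 1) + 1) = X * (2 * (2 * (a + 1) + 1)) := by ring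
    _ ≤ X * (4 * (2 * a + 1)) := Nat.mul_le_mul_left _ (by omega)
    _ = (X * (2 * a + 1)) * 4 := by ring
    _ ≤ 4 ^ a * 4 := Nat.mul_le_mul_right _ h

/-- **REGIME TWO FROM A BASE**: `2^{p+q}·2^{2^q−1−q}·(2(p−1−q)+1) ≤ 4^{p−1−q}` for every `p ≥ p₀` once it holds at `p₀ ≥ q + 2`. -/
theorem regime_two_of_base (q p₀ : ℕ) (hp₀ : q + 2 ≤ p₀)
    (hbase : 2 ^ (p₀ + q) * 2 ^ (2 ^ q - 1 - q) * (2 * (p₀ - 1 - q) + 1) ≤ 4 ^ (p₀ - 1 - q)) :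
    ∀ p, p₀ ≤ p → 2 ^ (p + q) * 2 ^ (2 ^ q - 1 - q) * (2 * (p - 1 - q) + 1) ≤ 4 ^ (p - 1 - q) := by
  intro p hp
  induction p, hp using Nat.le_induction with
  | base => exact hbase
  | succ p hp ih => exact regime_two_succ q p (by omega) ih

end Explicit

variable {α : Type}

/-- **THE LARGE-CORANK CORE FROM BOTH BASES**: corank `≥ q + 2^q + 1`, `p ≥ N₁` (regime one from `N₁`), `p ≥ P₂` (regime
two from `P₂`), `p ≥ 2^q + 2` (`q ≥ 3`) — `c025_core_explicit_large'` with both thresholds parameters. -/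
theorem c025_core_explicit_large_of' (q : ℕ) (hq : 3 ≤ q) (N₁ P₂ : ℕ)
    (hN₁ : ∀ n, N₁ ≤ n → 8 * (q + 1) * 2 ^ (2 ^ q - 1 - q) * n ^ q ≤ 2 ^ n)
    (hP₂ : ∀ p, P₂ ≤ p → 2 ^ (p + q) * 2 ^ (2 ^ q - 1 - q) * (2 * (p - 1 - q) + 1) ≤ 4 ^ (p - 1 - q))
    (M : Matroid α) [M.Finite] (p : ℕ) (hp : N₁ ≤ p) (hp2 : P₂ ≤ p) (hp3 : 2 ^ q + 2 ≤ p)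
    (hR : M.eRank = (p : ℕ∞)) (hbig : p + q + 2 ^ q < M.E.ncard)
    (hfree : ∀ e ∈ M.E, ∃ A ⊆ M.E \ {e}, e ∉ M.closure A ∧ e ∉ M.closure ((M.E \ {e}) \ A)) :
    RLS M p q := by
  have hq1 := Explicit.succ_le_two_pow q
  refine core_all_corank_of_thresholds_of_bound q (2 ^ q - 1) (by omega) (by omega) N₁ P₂ hN₁ hP₂ M p ?_ hR ?_ hfree ?_
  · exact max_le (max_le hp hp2) hp3
  · omega
  · intro j hj X hX hr
    have hL := not_isLoop_of_free M hfree
    have h1 := ncard_add_one_le_two_pow_of_eRk_le M hL hfree j X hX hr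
    have h2 := Explicit.two_pow_add_le_two_pow_add j q hj
    omega

/-- **THE LEVEL FROM ONE EVALUATED ROW OF ANY KEY, WITH THE CHERNOFF TAIL AND THE LARGE-CORANK THEOREM FROM BASES**:
level `q + 1 ≥ 8` for every finite matroid and every `p ≥ p₀` from (i) level `q` for every `p ≥ p₀ − 1`, (ii) a key
predicate `K p d` (level `q + 1`) monotone in `p` (`hmono`) whose core law closes the `e`-free core cell `(p, d)`,
`q + 2 ≤ d ≤ q + 1 + 2^{q+1}`, under the tail inequality `16·Σ_{j ≤ q+1+d} C(p+d, j) ≤ 2^{p+d}` (`hcore`), (iii) the row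
`K p₀ d` at every core corank, (iv) the tail `8p₀ ≥ 9(q + 1 + 2^{q+1}) + 17(q+1) + 216` (the Chernoff tail at the largest
core corank), (v) the large-corank theorem from the bases `N₁ ≤ p₀` (regime one; `2(q+1) ≤ N₁`, kernel `hbase₁`) and
`P₂ ≤ p₀` (regime two; `q + 3 ≤ P₂`, kernel `hbase₂`) with `2^{q+1} + 2 ≤ p₀`. -/
theorem c025_level_succ_of_key_row_tail (q : ℕ) (hq : 7 ≤ q) (p₀ N₁ P₂ : ℕ) (K : ℕ → ℕ → Prop)
    (hN₁ : N₁ ≤ p₀) (hm : 2 * (q + 1) ≤ N₁)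
    (hbase₁ : 8 * (q + 1 + 1) * 2 ^ (2 ^ (q + 1) - 1 - (q + 1)) * N₁ ^ (q + 1) ≤ 2 ^ N₁)
    (hP₂ : P₂ ≤ p₀) (hP₂q : q + 1 + 2 ≤ P₂)
    (hbase₂ : 2 ^ (P₂ + (q + 1)) * 2 ^ (2 ^ (q + 1) - 1 - (q + 1)) * (2 * (P₂ - 1 - (q + 1)) + 1) ≤
      4 ^ (P₂ - 1 - (q + 1)))
    (hp3 : 2 ^ (q + 1) + 2 ≤ p₀)
    (htail : 9 * (q + 1 + 2 ^ (q + 1)) + 17 * (q + 1) + 216 ≤ 8 * p₀)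
    (hmono : ∀ p d, q + 1 ≤ d → K p d → K (p + 1) d)
    (hcore : ∀ (M : Matroid α) [M.Finite] (p d : ℕ), q + 2 ≤ d → d ≤ q + 1 + 2 ^ (q + 1) →
      16 * ∑ j ∈ Finset.range (q + 1 + d + 1), (p + d).choose j ≤ 2 ^ (p + d) →
      K p d → M.eRank = (p : ℕ∞) → M.E.ncard = p + d →
      (∀ e ∈ M.E, ∃ A ⊆ M.E \ {e}, e ∉ M.closure A ∧ e ∉ M.closure ((M.E \ {e}) \ A)) → RLS M p (q + 1))
    (hrow : ∀ t < 2 ^ (q + 1), K p₀ (q + 2 + t))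
    (hprev : ∀ (M : Matroid α) [M.Finite] (p : ℕ), p₀ - 1 ≤ p → RLS M p q) :
    ∀ (M : Matroid α) [M.Finite] (p : ℕ), p₀ ≤ p → RLS M p (q + 1) := by
  intro M _ p hp
  have h2q : 2 ≤ 2 ^ (q + 1 + 1) := by
    calc 2 = 2 ^ 1 := by norm_num
      _ ≤ 2 ^ (q + 1 + 1) := Nat.pow_le_pow_right (by norm_num) (by omega)
  refine rls_succ_large_at (α := α) q (q + 1) p (by omega) (fun M' _ => hprev M' (p - 1) (by omega)) ?_ ?_ M
  · intro M' _ hn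
    rcases Nat.lt_or_ge M'.E.ncard (p + (q + 1)) with h | h
    · exact RLS_of_ncard_lt M' h
    · exact RLS_of_ncard_eq M' (by omega)
  · intro M' _ hR hbig hfree
    rcases Nat.lt_or_ge M'.E.ncard (p + (q + 1) + 2 ^ (q + 1) + 1) with h | h
    · have hkey0 := hrow (M'.E.ncard - p - (q + 2)) (by omega)
      rw [show q + 2 + (M'.E.ncard - p - (q + 2)) = M'.E.ncard - p by omega] at hkey0
      have hkey := key_mono_of_succ K (M'.E.ncard - p) (fun p' => hmono p' (M'.E.ncard - p) (by omega)) p₀ p hp hkey0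
      have hT := Explicit.sixteen_mul_sum_range_choose_le_chernoff (q + 1 + (M'.E.ncard - p)) (p + (M'.E.ncard - p))
        (by omega)
      exact hcore M' p (M'.E.ncard - p) (by omega) (by omega) hT hkey hR (by omega) hfree
    · exact c025_core_explicit_large_of' (q + 1) (by omega) N₁ P₂ (Explicit.regime_one_of_base (q + 1) N₁ hm hbase₁)
        (Explicit.regime_two_of_base (q + 1) P₂ hP₂q hbase₂) M' p (hN₁.trans hp) (hP₂.trans hp) (hp3.trans hp) hR
        (by omega) hfree

end ThmN

end PercRepro
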